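import Summits.BirchSwinnertonDyer.BirchSwinnertonDyer.Theorems.GoldfeldAllTwistsTwoConverseTwinBirchLemmaKrizLi7Twists
import HarnessLib

set_option linter.dupNamespace false -- namespace `…BirchSwinnertonDyer.BirchSwinnertonDyer…` is the cell's (D-0017 nested layout)
set_option autoImplicit false

/-!
# LINE B49, file 4f — the CERTIFICATE KIT: a generic `θ₁`-certificate for Kriz–Li Thm. 1.20 at `p = 7` on `X₀(49)`
# over `ℚ(√−q)`, so that each further prime `q` costs ONE `decide +kernel` sum; members `q = 173, 181`

Cell `bsd-goldfeld`, seat `bsd-goldfeld-s1p-c301` (prover, gen 5). `--supports` the S1⁺ route items stmt-BirchSwinnertonDyer-20044 (K12₂″)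
/ 19140 (twin″). Files 4c/4d (`…KrizLi7Certificates{,B}`) certified `q = 41, 61, 73, 89, 101` by COPYING bsd-cm's per-member
proof (`RouteUMemberE52` pattern, ≈ 55 lines each). This file proves that pattern ONCE for a VARIABLE prime `q ≡ 1 (mod 4)`,
`q ≠ 7`: **`norm_generalizedBernoulli_theta1_prime_of_sum`** — from the single integer identity
`Σ_{j<28q} χ₄(j)·(j/q)·j²⁹ = S` (to be evaluated by `decide +kernel` after `RouteU.jacobiSym_prime_eq_ite_nat q`) with `7 ∣ S`,
`49 ∤ S`, the certificate `‖B_{1,θ}‖₇ = 1` for every Teichmüller `ω` and every `θ` mod `7·4q` with values `[j odd]·(−q/j)·ω(j)⁴`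
(bsd-cm's `hcert₁` shape = the hypothesis of files 4/4b). Generic ingredients: `ord₇(7·4q) = 1`; the Kronecker value in reciprocity
form `χ₄(j)·(j/q)` (`RouteU.jacobiSym_neg_eq_χ₄_mul`, any `q ≡ 1 (mod 4)`); `θ ≠ 1` by the witness `j = 28q − 1 ≡ −1`
(`χ₄(−1)·(−1/q)·ω(−1)⁴ = −1` since `(−1/q) = χ₄(q) = 1`, Mathlib `jacobiSym.at_neg_one`); then bsd-cm's mod-`49` certificate
`RouteU.norm_generalizedBernoulli_one_eq_one_of_cert_range` with `ω(j)⁴ ≡ j²⁸ (mod 49)` (`RouteU.norm_sub_le_of_values`). Wrapped with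
files 4/4b: **`not_isOfFinAddOrder_heegnerPoint_cm7_of_sum`** (T1 from the sum) and **`analyticRank_eq_one_inertPrimeTwist_of_sum`**
(«D(q)» from the sum). Members here: `q = 173` (`S mod 49 = 28`) and `q = 181` (`S mod 49 = 7`) — planner g12's census values.
HONEST FRAMING: RANK axis at `p = 7` only; each member is one more element of a twist-density-zero WITNESS family; both items OPEN;
BSD is not proved by any of this. THEOREMS ONLY (no `def`, no instance, no named fact).

References: [KrizLi2019] Thm. 1.20 (pp. 7–8), §1.5 (1); [Washington1997] §5.1, Thm. 4.2; [Cox2013] §1.C Lemma 1.14; [GrossZagier1986] I.(6.3).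
-/

noncomputable section

open scoped Classical NumberTheorySymbols

open WeierstrassCurve NumberField DirichletCharacter
open Literature.NumberTheory Literature.NumberTheory.EllipticCurves
  Literature.NumberTheory.EllipticCurves.ModularForms
open Literature.NumberTheory.EllipticCurves.KrizLi2019 Literature.NumberTheory.LFunctions
open Summit.BirchSwinnertonDyer.Rank1Residual
open Summit.BirchSwinnertonDyer.Rank1Residual.X12.O11.RouteU

namespace Summit.BirchSwinnertonDyer.BirchSwinnertonDyer.Theorems.GoldfeldGoodTwists

/-! ## §1 The generic certificate for a prime `q ≡ 1 (mod 4)`, `q ≠ 7` -/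

/-- `ord₇ (7·4q) = 1` for a prime `q ≠ 7`. [folklore] -/
theorem padicValNat_seven_mul_four_mul_prime {q : ℕ} [Fact q.Prime] (hq7 : q ≠ 7) :
    padicValNat 7 (7 * (4 * q)) = 1 := by
  have hq : q.Prime := Fact.out
  have h : ¬ 7 ∣ 4 * q := by
    intro hd
    rcases (Nat.Prime.dvd_mul (by norm_num)).mp hd with h | h
    · revert h; decide
    · exact hq7 ((Nat.prime_dvd_prime_iff_eq (by norm_num) hq).mp h).symm
  rw [padicValNat.mul (by norm_num) (Nat.pos_iff_ne_zero.mp (by have := hq.pos; omega)), padicValNat_self,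
    padicValNat.eq_zero_of_not_dvd h]

/-- **The Kronecker value of `d = −4q` in reciprocity form**, `q ≡ 1 (mod 4)`: `[a odd]·(−q/a) = χ₄(a)·(a/q)`.
[cite: Cox2013, §1.C Lemma 1.14 and (1.15)–(1.18)] -/
theorem kroneckerVal_negPrime_eq {q : ℕ} (hq4 : q % 4 = 1) (a : ℕ) :
    (if Even a then (0 : ℤ) else J(-(q : ℤ) | a)) =
      (if a % 2 = 0 then (0 : ℤ) else if a % 4 = 1 then 1 else -1) * J((a : ℤ) | q) := by
  by_cases ha0 : Even a
  · rw [if_pos ha0, if_pos (Nat.even_iff.mp ha0), zero_mul]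
  · have ha : Odd a := Nat.not_even_iff_odd.mp ha0
    rw [if_neg ha0, jacobiSym_neg_eq_χ₄_mul hq4 ha, ZMod.χ₄_nat_eq_if_mod_four]

set_option maxRecDepth 400000 in
/-- **THE GENERIC `θ₁`-CERTIFICATE.** For a prime `q ≡ 1 (mod 4)`, `q ≠ 7`: if the integer
`S = Σ_{j<28q} χ₄(j)·(j/q)·j²⁹` (sum over `Finset.range (7·(4·q))`) satisfies `7 ∣ S` and `7² ∤ S`, then `‖B_{1,θ}‖₇ = 1` for every
Teichmüller `ω` mod `7` and every Dirichlet character `θ` mod `7·4q` with values `[j odd]·(−q/j)·ω(j)⁴` — the Bernoulli certificate of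
Kriz–Li Thm. 1.20 for `(X₀(49), 7, ℚ(√−q))` in bsd-cm's `hcert₁` shape (the hypothesis `hcert` of files 4/4b of the line). Proof = bsd-cm's
`RouteUMemberE52` proof made uniform in `q` (witness of `θ ≠ 1`: `j = 28q − 1`, where the value is `χ₄(−1)·(−1/q) = −1`).
[cite: KrizLi2019, Thm. 1.20 (p. 8) and §1.5 (1)] [cite: Washington1997, §5.1 and Thm. 4.2] -/
theorem norm_generalizedBernoulli_theta1_prime_of_sum {q : ℕ} [Fact q.Prime] (hq4 : q % 4 = 1) (hq7 : q ≠ 7)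
    (S : ℤ)
    (hS : ∑ j ∈ Finset.range (7 * (4 * q)),
      ((if j % 2 = 0 then (0 : ℤ) else if j % 4 = 1 then 1 else -1) * J((j : ℤ) | q)) * (j : ℤ) ^ (28 + 1) = S)
    (h1 : (7 : ℤ) ∣ S) (h2 : ¬ (7 : ℤ) ^ 2 ∣ S)
    (ω : DirichletCharacter ℚ_[7] 7) (hω : IsTeichmullerCharacter ω) (θ : DirichletCharacter ℚ_[7] (7 * (4 * q)))
    (hθ : ∀ j : ZMod (7 * (4 * q)), θ j =
      ((if Even j.val then (0 : ℤ) else J(-(q : ℤ) | j.val) : ℤ) : ℚ_[7]) * ω (j.val : ZMod 7) ^ 4) :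
    ‖generalizedBernoulli 1 θ‖ = 1 := by
  have hq : q.Prime := Fact.out
  have hq0 : 0 < q := hq.pos
  have hqodd : Odd q := Nat.odd_iff.mpr (by omega)
  have hθ' : ∀ j : ZMod (7 * (4 * q)), θ j =
      (((if j.val % 2 = 0 then (0 : ℤ) else if j.val % 4 = 1 then 1 else -1) * J((j.val : ℤ) | q) : ℤ) : ℚ_[7]) *
        ω (j.val : ZMod 7) ^ 4 :=
    fun j => by rw [hθ j, kroneckerVal_negPrime_eq hq4]
  have hθ1 : θ ≠ 1 := by
    intro h1
    -- the witness `w = 28q − 1 ≡ −1`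
    obtain ⟨w, hw⟩ : ∃ w : ℕ, w + 1 = 7 * (4 * q) := ⟨7 * (4 * q) - 1, by omega⟩
    have hv := hθ' ((w : ℕ) : ZMod (7 * (4 * q)))
    have hval : ((w : ℕ) : ZMod (7 * (4 * q))).val = w := by
      rw [ZMod.val_natCast]; exact Nat.mod_eq_of_lt (by omega)
    have hw7 : ((w : ℕ) : ZMod 7) = ((6 : ℕ) : ZMod 7) := by
      rw [ZMod.natCast_eq_natCast_iff']; omega
    have hu : IsUnit ((w : ℕ) : ZMod (7 * (4 * q))) := by
      rw [ZMod.isUnit_iff_coprime, ← hw]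
      exact Nat.coprime_self_add_right.mpr (Nat.coprime_one_right _)
    rw [h1, hval, MulChar.one_apply hu, hw7, apply_neg_one_pow_four, mul_one] at hv
    have hJ : J((w : ℤ) | q) = 1 := by
      have hwq : (w : ℤ) % (q : ℤ) = (-1 : ℤ) % (q : ℤ) := by
        have : (w : ℤ) = -1 + (q : ℤ) * 28 := by omega
        rw [this, Int.add_mul_emod_self_left]
      rw [jacobiSym.mod_left, hwq, ← jacobiSym.mod_left, jacobiSym.at_neg_one hqodd, ZMod.χ₄_nat_one_mod_four hq4]
    have hL : ((if w % 2 = 0 then (0 : ℤ) else if w % 4 = 1 then 1 else -1) * J((w : ℤ) | q)) = -1 := by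
      rw [if_neg (by omega), if_neg (by omega), hJ]; norm_num
    rw [hL] at hv
    norm_num at hv
  refine norm_generalizedBernoulli_one_eq_one_of_cert_range θ hθ1 (padicValNat_seven_mul_four_mul_prime hq7)
    (fun j => (if j % 2 = 0 then (0 : ℤ) else if j % 4 = 1 then 1 else -1) * J((j : ℤ) | q)) 28 (fun j => ?_)
    S hS h1 h2
  have := norm_sub_le_of_values ω hω θ
    (fun j => (if j % 2 = 0 then (0 : ℤ) else if j % 4 = 1 then 1 else -1) * J((j : ℤ) | q)) 4 (by norm_num) hθ' j
  simpa using this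

/-! ## §2 T1 and «D(q)» straight from the sum -/

/-- For `(q/7) = −1`: `q ≠ 7`. [folklore] -/
theorem ne_seven_of_jacobiSym_seven {q : ℕ} (hq7 : jacobiSym q 7 = -1) : q ≠ 7 := by
  rintro rfl
  exact absurd hq7 (by norm_num)

/-- **T1 from the sum**: every level-`49` Heegner point of `X₀(49)` over `K` (`d_K = −4q`) has infinite order, for a prime
`q ≡ 1 (mod 4)`, `(q/7) = −1`, whose certificate sum `S` has `7 ∥ S` — granted KL19 Thm. 1.20 (file 4's T1 + §1).
[cite: KrizLi2019, Thm. 1.20 (pp. 7–8) and Rem. 1.21] -/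
theorem not_isOfFinAddOrder_heegnerPoint_cm7_of_sum (h120 : thm120_padicLogHeegner_unit_of_bernoulli)
    {q : ℕ} [Fact q.Prime] (hq4 : q % 4 = 1) (hq7 : jacobiSym q 7 = -1) (S : ℤ)
    (hS : ∑ j ∈ Finset.range (7 * (4 * q)),
      ((if j % 2 = 0 then (0 : ℤ) else if j % 4 = 1 then 1 else -1) * J((j : ℤ) | q)) * (j : ℤ) ^ (28 + 1) = S)
    (h1 : (7 : ℤ) ∣ S) (h2 : ¬ (7 : ℤ) ^ 2 ∣ S)
    (K : Type) [Field K] [NumberField K] (hK : IsImaginaryQuadratic K) (hdK : NumberField.discr K = -(4 * (q : ℤ)))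
    {P : (cm7.baseChange K).toAffine.Point} (hP : IsHeegnerPoint 49 cm7 K P) : ¬ IsOfFinAddOrder P :=
  not_isOfFinAddOrder_heegnerPoint_cm7_of_thm120 h120 hq7
    (fun ω hω θ hθ => norm_generalizedBernoulli_theta1_prime_of_sum hq4 (ne_seven_of_jacobiSym_seven hq7) S hS h1 h2
      ω hω θ hθ) K hK hdK hP

/-- **«D(q)» from the sum**: `ord_{s=1} L(W, s) = 1` for every elliptic `W/ℚ` isomorphic to `49a1^{(−q)}`, for a prime
`q ≡ 1 (mod 4)`, `(q/7) = −1`, whose certificate sum `S` has `7 ∥ S` — granted KL19 Thm. 1.20, Modularity, CLTZ Thm. 1.2 (`R = 1`),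
Gross–Zagier, Heegner rationality (file 4b's T2 + §1). [cite: KrizLi2019, Thm. 1.20 (pp. 7–8)] [cite: GrossZagier1986, Thm. I.(6.3) and I.§7] -/
theorem analyticRank_eq_one_inertPrimeTwist_of_sum (h120 : thm120_padicLogHeegner_unit_of_bernoulli)
    (hnf : ModularForms.exists_isNewformOf) (h12 : CoatesLiTianZhai2015.thm12_fullBSD_twist)
    (hGZ : ∀ (N : ℕ) [NeZero N] (W : WeierstrassCurve ℚ) (K : Type) [Field K] [NumberField K],
      gross_zagier N W K)
    (hHP : ∀ (W : WeierstrassCurve ℚ) (K : Type) [Field K] [NumberField K], exists_isHeegnerPoint W K)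
    {q : ℕ} [Fact q.Prime] (hq4 : q % 4 = 1) (hq7 : jacobiSym q 7 = -1) (S : ℤ)
    (hS : ∑ j ∈ Finset.range (7 * (4 * q)),
      ((if j % 2 = 0 then (0 : ℤ) else if j % 4 = 1 then 1 else -1) * J((j : ℤ) | q)) * (j : ℤ) ^ (28 + 1) = S)
    (h1 : (7 : ℤ) ∣ S) (h2 : ¬ (7 : ℤ) ^ 2 ∣ S)
    (W : WeierstrassCurve ℚ) [W.IsElliptic] (C : VariableChange ℚ)
    (hC : C • W = cm7.quadraticTwist ((-q : ℤ) : ℚ)) : W.analyticRank = 1 :=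
  analyticRank_eq_one_inertPrimeTwist_of_thm120 h120 hnf h12 hGZ hHP hq4 hq7
    (fun ω hω θ hθ => norm_generalizedBernoulli_theta1_prime_of_sum hq4 (ne_seven_of_jacobiSym_seven hq7) S hS h1 h2
      ω hω θ hθ) W C hC

/-! ## §3 Members `q = 173` and `q = 181` (one kernel sum each) -/

set_option maxRecDepth 400000 in
/-- The certificate sum for `q = 173` (`4844` terms; `S ≡ 28 (mod 49)`), `decide +kernel`. [folklore] -/
theorem theta1_q173_sum :
    ∑ j ∈ Finset.range (7 * (4 * 173)),
      ((if j % 2 = 0 then (0 : ℤ) else if j % 4 = 1 then 1 else -1) * J((j : ℤ) | 173)) * (j : ℤ) ^ (28 + 1) =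
      (-841951475140715861473314211889912854757864975454872801582714181740431911512655895187496892694468871824408776) := by
  simp_rw [jacobiSym_prime_eq_ite_nat 173 (by norm_num) (by norm_num)]
  decide +kernel

set_option maxRecDepth 400000 in
/-- The certificate sum for `q = 181` (`5068` terms; `S ≡ 7 (mod 49)`), `decide +kernel`. [folklore] -/
theorem theta1_q181_sum :
    ∑ j ∈ Finset.range (7 * (4 * 181)),
      ((if j % 2 = 0 then (0 : ℤ) else if j % 4 = 1 then 1 else -1) * J((j : ℤ) | 181)) * (j : ℤ) ^ (28 + 1) =
      (-2060720914554068666873879259122137831282190572489578115522941766211730603594630696859065039510774810448385560) := by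
  simp_rw [jacobiSym_prime_eq_ite_nat 181 (by norm_num) (by norm_num)]
  decide +kernel

/-- **«D(173)»: `ord_{s=1} L(W, s) = 1` for every elliptic `W/ℚ` isomorphic to `49a1^{(−173)}`**, granted KL19 Thm. 1.20, Modularity,
CLTZ Thm. 1.2, Gross–Zagier, Heegner rationality. [cite: KrizLi2019, Thm. 1.20 (pp. 7–8)] [cite: GrossZagier1986, Thm. I.(6.3) and I.§7] -/
theorem analyticRank_eq_one_twist_cm7_neg173 (h120 : thm120_padicLogHeegner_unit_of_bernoulli)
    (hnf : ModularForms.exists_isNewformOf) (h12 : CoatesLiTianZhai2015.thm12_fullBSD_twist)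
    (hGZ : ∀ (N : ℕ) [NeZero N] (W : WeierstrassCurve ℚ) (K : Type) [Field K] [NumberField K],
      gross_zagier N W K)
    (hHP : ∀ (W : WeierstrassCurve ℚ) (K : Type) [Field K] [NumberField K], exists_isHeegnerPoint W K)
    (W : WeierstrassCurve ℚ) [W.IsElliptic] (C : VariableChange ℚ) (hC : C • W = cm7.quadraticTwist (-173)) :
    W.analyticRank = 1 :=
  haveI : Fact (Nat.Prime 173) := ⟨by norm_num⟩
  analyticRank_eq_one_inertPrimeTwist_of_sum h120 hnf h12 hGZ hHP (q := 173) (by norm_num) (by norm_num) _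
    theta1_q173_sum (by norm_num) (by norm_num) W C (by rw [hC]; norm_num)

/-- **«D(181)»: `ord_{s=1} L(W, s) = 1` for every elliptic `W/ℚ` isomorphic to `49a1^{(−181)}`**, granted the same five named facts.
[cite: KrizLi2019, Thm. 1.20 (pp. 7–8)] [cite: GrossZagier1986, Thm. I.(6.3) and I.§7] -/
theorem analyticRank_eq_one_twist_cm7_neg181 (h120 : thm120_padicLogHeegner_unit_of_bernoulli)
    (hnf : ModularForms.exists_isNewformOf) (h12 : CoatesLiTianZhai2015.thm12_fullBSD_twist)
    (hGZ : ∀ (N : ℕ) [NeZero N] (W : WeierstrassCurve ℚ) (K : Type) [Field K] [NumberField K],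
      gross_zagier N W K)
    (hHP : ∀ (W : WeierstrassCurve ℚ) (K : Type) [Field K] [NumberField K], exists_isHeegnerPoint W K)
    (W : WeierstrassCurve ℚ) [W.IsElliptic] (C : VariableChange ℚ) (hC : C • W = cm7.quadraticTwist (-181)) :
    W.analyticRank = 1 :=
  haveI : Fact (Nat.Prime 181) := ⟨by norm_num⟩
  analyticRank_eq_one_inertPrimeTwist_of_sum h120 hnf h12 hGZ hHP (q := 181) (by norm_num) (by norm_num) _
    theta1_q181_sum (by norm_num) (by norm_num) W C (by rw [hC]; norm_num)

/-- **The Heegner points over `ℚ(√−173)` and `ℚ(√−181)` have infinite order** (`d_K = −692, −724`), granted KL19 Thm. 1.20.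
[cite: KrizLi2019, Thm. 1.20 (pp. 7–8) and Rem. 1.21] -/
theorem not_isOfFinAddOrder_heegnerPoint_cm7_discr_neg692_neg724 (h120 : thm120_padicLogHeegner_unit_of_bernoulli)
    (K : Type) [Field K] [NumberField K] (hK : IsImaginaryQuadratic K)
    (hdK : NumberField.discr K = -692 ∨ NumberField.discr K = -724)
    {P : (cm7.baseChange K).toAffine.Point} (hP : IsHeegnerPoint 49 cm7 K P) : ¬ IsOfFinAddOrder P := by
  rcases hdK with hdK | hdK
  · haveI : Fact (Nat.Prime 173) := ⟨by norm_num⟩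
    exact not_isOfFinAddOrder_heegnerPoint_cm7_of_sum h120 (q := 173) (by norm_num) (by norm_num) _ theta1_q173_sum
      (by norm_num) (by norm_num) K hK (by rw [hdK]; norm_num) hP
  · haveI : Fact (Nat.Prime 181) := ⟨by norm_num⟩
    exact not_isOfFinAddOrder_heegnerPoint_cm7_of_sum h120 (q := 181) (by norm_num) (by norm_num) _ theta1_q181_sum
      (by norm_num) (by norm_num) K hK (by rw [hdK]; norm_num) hP

end Summit.BirchSwinnertonDyer.BirchSwinnertonDyer.Theorems.GoldfeldGoodTwists

end
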